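import Summits.BirchSwinnertonDyer.BirchSwinnertonDyer.Theorems.ByReductionTypeAtTwoTowerLayerTorsion
import Summits.BirchSwinnertonDyer.BirchSwinnertonDyer.Theorems.ByReductionTypeAtTwoTowerClassKitB
import Summits.BirchSwinnertonDyer.BirchSwinnertonDyer.Theorems.ByReductionTypeAtTwoTowerLayerKatoHalf
import Summits.BirchSwinnertonDyer.BirchSwinnertonDyer.Theorems.Rank2ShaTierKitW16P
import HarnessLib

/-!
# TOWER-road class instances — KIT, part D: the INELIG block (`E(ℚ)[2] ≠ 0`) — the torsion count
# `#E[2^∞]^{Γ_ℚ} ≤ 2^{v₂ #E(ℚ)_tors} ≤ 2^{v₂ #Ẽ(𝔽_ℓ)}`, the torsion-tolerant gap door in certificate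
# currency, and the doors AT `W` with the Néron-period binder DISPLAYED (route ByReductionTypeAtTwo,
# items 19573 / 19271; seat bsd-2adic-ord-2 GEN 4)

HONEST FRAMING (cell `bsd-2adic`, run/shared/lean/pub/bsd-2adic/, HUMAN RULINGS D-0036 / D-0054 / D-0074):
THEOREMS ONLY; nothing asserted; no definition; no new named fact; closes nothing by itself.

On the 86 INELIG classes of the open X5@2 good-ordinary block every member has a rational `2`-torsion
point, so (i) tower-1's exact count needs the torsion-tolerant form (`…TowerLayerTorsion.lean`,
`TowerClass.towerGapAtTwo_of_counts_of_torsion_zero`: one extra certificate `#E[2^∞]^{Γ_ℚ} ≤ 2^t`), and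
(ii) the Néron-period binder `hper₀` is NOT print (Greenberg–Vatsal Rem. 3.4 / Abbes–Ullmo give a `2`-adic
UNIT only when `E[2]` is irreducible; along a `2`-isogeny the Néron period moves by a power of `2`) — it is
DISPLAYED, to be discharged per class at the `X₀(N)`-optimal member (Cremona optimality + Abbes–Ullmo
Thm. A: `Ω(E₀) = |c₀|·Ω⁺_f`, `c₀` odd), the member the `∃`-isogenous item 19573 lets one choose.

* §1 `natCard_fixedPoints_geomPrimaryTorsion_le_pow` — **`#E[p^∞]^{Γ_ℚ} ≤ p^t` whenever
  `ord_p #E(ℚ)_tors ≤ t`** (any prime `p`): Galois descent (`exists_toGeomPoints_eq_of_forall_smul_eq`)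
  embeds the fixed points into `E(ℚ)[p^v]`, `v = ord_p #E(ℚ)_tors`, a `p`-group inside `E(ℚ)_tors`
  (`IsPGroup.iff_card`, Lagrange, `padicValNat_dvd_iff_le`); with the tree's
  `Rank2Sha.padicValNat_torsionOrder_le_of_good` (`ord_p #E(ℚ)_tors ≤ ord_p #Ẽ(𝔽_ℓ)`, good `ℓ ≥ 3`) the
  certificate becomes a point count: `…_le_pow_of_good`.
* §2 `towerGapAtTwo_of_counts_of_torsionOrder` / `…_of_goodPrime` — the gap door of
  `…TowerLayerTorsion` §2 at `j = 0` with `htor` replaced by `ord₂ #E(ℚ)_tors ≤ t`, resp. by a good odd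
  prime `ℓ` with `ord₂ #Ẽ(𝔽_ℓ) ≤ t` (kernel-decidable for an integer model).
* §3 the doors AT `W` with `hper₀` displayed: Kato half (tower-1's `KatoHalfPinch.katoHalfAt_two_of_towerGap_of_neron`,
  re-exported here in the ∃-isogenous form of item 19573), `MissingUpperBoundAt W 2`
  (`missingUpperBoundAt_two_of_towerGap_of_neron`); `BSD₂`/IMC are ord-3's
  `EisensteinShaCurrency.bsdp_two_of_towerGap_of_missingLowerBoundAt` / `…mazurMainConjecture…` (not repeated).

References: [GreenbergLNM1716] §1 p. 60 and p. 62, §3 pp. 85–86, §4 Lemma 4.3; [SilvermanAEC2009] VII.3.1(b),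
VIII.§1; [Kato2004Asterisque] Thm. 17.4; [MazurTateTeitelbaum1986Invent] §I.12; [AbbesUllmo1996] Thm. A.
-/

set_option autoImplicit false
-- the route's Theorems namespace repeats a component by design (summit = sub-problem, D-0017).
set_option linter.dupNamespace false

noncomputable section

open scoped Classical MatrixGroups ModularForm

open NumberField CongruenceSubgroup WeierstrassCurve Literature.NumberTheory.EllipticCurves
  Literature.NumberTheory.EllipticCurves.ModularForms Literature.NumberTheory.EllipticCurves.Rank1Residual
  Literature.NumberTheory.EllipticCurves.Rank1Residual.Typed
  Summit.BirchSwinnertonDyer.Rank1Residual.X5 Summit.BirchSwinnertonDyer.Rank1Residual.X5.O1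
  Summit.BirchSwinnertonDyer.Rank1Residual.X5.TowerGap Summit.BirchSwinnertonDyer.Rank1Residual
  Summit.BirchSwinnertonDyer.BirchSwinnertonDyer.Theorems.KatoHalfPinch

universe u

namespace Summit.BirchSwinnertonDyer.BirchSwinnertonDyer.Theorems.TowerClass

/-! ## §1 The torsion count `#E[p^∞]^{Γ_K} ≤ p^{ord_p #E(K)_tors}` (any number field) -/

section NumberField

variable {K : Type u} [Field K] [NumberField K] (W : WeierstrassCurve K) [W.IsElliptic]

/-- **`#E[p^∞]^{Γ_ℚ} ≤ p^t` when `ord_p #E(ℚ)_tors ≤ t`.** A `Γ_ℚ`-fixed point of `E[p^∞] ⊆ E(ℚ̄)` is the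
image of a rational point (Galois descent), which is torsion of `p`-power order dividing `#E(ℚ)_tors`, hence
killed by `p^v`, `v = ord_p #E(ℚ)_tors`; and `E(ℚ)[p^v]` is a `p`-group inside `E(ℚ)_tors`, of order a power
of `p` dividing `#E(ℚ)_tors`, so at most `p^v`. [cite: SilvermanAEC2009, VIII.§1 (Galois descent) and VII.3]
[cite: GreenbergLNM1716, §4 Lemma 4.3 (`|E(F)_p|`)] -/
theorem natCard_fixedPoints_geomPrimaryTorsion_le_pow (p : ℕ) [hp : Fact p.Prime] {t : ℕ}
    (ht : padicValNat p W.torsionOrder ≤ t) :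
    Nat.card (MulAction.fixedPoints (Field.absoluteGaloisGroup K) (geomPrimaryTorsion W p)) ≤ p ^ t := by
  set v := padicValNat p W.torsionOrder with hv
  have hn0 : W.torsionOrder ≠ 0 := (W.torsionOrder_pos_holds).ne'
  have hnT : W.torsionOrder = Nat.card (AddCommGroup.torsion W.toAffine.Point) := rfl
  haveI hfinT : Finite (AddCommGroup.torsion W.toAffine.Point) := W.finite_torsion_point
  -- `H = E(ℚ)[p^v]`
  let H : AddSubgroup W.toAffine.Point := (DistribSMul.toAddMonoidHom W.toAffine.Point (p ^ v)).ker
  have hH : ∀ P, P ∈ H ↔ p ^ v • P = 0 := fun P ↦ by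
    simp only [H, AddMonoidHom.mem_ker, DistribSMul.toAddMonoidHom_apply]
  have hHT : H ≤ AddCommGroup.torsion W.toAffine.Point := fun P hP ↦ by
    rw [AddCommGroup.mem_torsion]
    exact isOfFinAddOrder_iff_nsmul_eq_zero.mpr ⟨p ^ v, pow_pos hp.out.pos _, (hH P).mp hP⟩
  haveI hfinH : Finite H := Finite.of_injective _ (AddSubgroup.inclusion_injective hHT)
  -- `#H = p^j ∣ #E(ℚ)_tors`, so `j ≤ v`
  have hpg : IsPGroup p (Multiplicative H) := fun g ↦ ⟨v, by
    apply Multiplicative.toAdd.injective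
    rw [toAdd_pow, toAdd_one]
    exact Subtype.ext (by
      rw [AddSubgroup.coe_nsmul, AddSubgroup.coe_zero]; exact (hH _).mp (Multiplicative.toAdd g).2)⟩
  obtain ⟨j, hj⟩ := IsPGroup.iff_card.mp hpg
  have hjH : Nat.card H = p ^ j := by
    rw [← hj]; exact Nat.card_congr Multiplicative.ofAdd
  have hdvd : p ^ j ∣ W.torsionOrder := by
    rw [hnT, ← hjH]; exact AddSubgroup.card_dvd_of_le hHT
  have hjv : j ≤ v := (padicValNat_dvd_iff_le hn0).mp hdvd
  -- the injection `E[p^∞]^{Γ_ℚ} ↪ H` by Galois descent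
  have hdesc : ∀ m : MulAction.fixedPoints (Field.absoluteGaloisGroup K) (geomPrimaryTorsion W p),
      ∃ P : W.toAffine.Point, P ∈ H ∧ toGeomPoints W P = ((m : geomPrimaryTorsion W p) : geomPoints W) := by
    intro m
    have hfix : ∀ σ : Field.absoluteGaloisGroup K,
        σ • ((m : geomPrimaryTorsion W p) : geomPoints W) = ((m : geomPrimaryTorsion W p) : geomPoints W) :=
      fun σ ↦ by rw [← primaryComponent.coe_smul, MulAction.mem_fixedPoints.mp m.2 σ]
    obtain ⟨P, hP⟩ := exists_toGeomPoints_eq_of_forall_smul_eq W hfix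
    obtain ⟨k, hk⟩ := (m : geomPrimaryTorsion W p).2
    -- `p^k • P = 0`
    have hPk : p ^ k • P = 0 := by
      apply toGeomPoints_injective W
      rw [map_nsmul, hP, map_zero]
      exact hk
    -- `addOrderOf P = p^i` with `p^i ∣ #E(ℚ)_tors`
    have hfin : IsOfFinAddOrder P := isOfFinAddOrder_iff_nsmul_eq_zero.mpr ⟨p ^ k, pow_pos hp.out.pos _, hPk⟩
    obtain ⟨i, -, hi⟩ := (Nat.dvd_prime_pow hp.out).mp (addOrderOf_dvd_of_nsmul_eq_zero hPk)
    have hmemT : P ∈ AddCommGroup.torsion W.toAffine.Point := by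
      rw [AddCommGroup.mem_torsion]; exact hfin
    have hiT : p ^ i ∣ W.torsionOrder := by
      rw [hnT, ← hi, ← AddSubgroup.addOrderOf_mk P hmemT]
      exact addOrderOf_dvd_natCard _
    have hiv : i ≤ v := (padicValNat_dvd_iff_le hn0).mp hiT
    refine ⟨P, (hH P).mpr ?_, hP⟩
    exact addOrderOf_dvd_iff_nsmul_eq_zero.mp (hi ▸ pow_dvd_pow p hiv)
  have hinj : Nat.card (MulAction.fixedPoints (Field.absoluteGaloisGroup K) (geomPrimaryTorsion W p)) ≤
      Nat.card H := by
    refine Nat.card_le_card_of_injective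
      (fun m ↦ (⟨(hdesc m).choose, (hdesc m).choose_spec.1⟩ : H)) fun m m' hmm' ↦ ?_
    have h1 := (hdesc m).choose_spec.2
    have h2 := (hdesc m').choose_spec.2
    have heq : (hdesc m).choose = (hdesc m').choose := congrArg (fun x : H ↦ (x : W.toAffine.Point)) hmm'
    rw [heq, h2] at h1
    exact Subtype.ext (Subtype.ext h1.symm)
  calc Nat.card (MulAction.fixedPoints (Field.absoluteGaloisGroup K) (geomPrimaryTorsion W p))
      ≤ Nat.card H := hinj
    _ = p ^ j := hjH
    _ ≤ p ^ v := Nat.pow_le_pow_right hp.out.pos hjv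
    _ ≤ p ^ t := Nat.pow_le_pow_right hp.out.pos ht

end NumberField

section Rat

variable (W : WeierstrassCurve ℚ) [W.IsElliptic]

/-- **The torsion certificate from a point count**: at a prime `ℓ ≥ 3` of good reduction,
`ord_p #E(ℚ)_tors ≤ ord_p #Ẽ(𝔽_ℓ)` (tree `Rank2Sha.padicValNat_torsionOrder_le_of_good`, Silverman VII.3.1(b)),
so `ord_p #Ẽ(𝔽_ℓ) ≤ t ⇒ #E[p^∞]^{Γ_ℚ} ≤ p^t`. [cite: SilvermanAEC2009, VII.3 Prop. 3.1(b)] -/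
theorem natCard_fixedPoints_geomPrimaryTorsion_le_pow_of_good [W.IsGloballyMinimal] (p ℓ : ℕ)
    [Fact p.Prime] [Fact ℓ.Prime] (h3 : 3 ≤ ℓ) (hgood : W.HasGoodReductionAtPrime ℓ) {t : ℕ}
    (hℓ : padicValNat p (W.reductionPointCount ℓ) ≤ t) :
    Nat.card (MulAction.fixedPoints (Field.absoluteGaloisGroup ℚ) (geomPrimaryTorsion W p)) ≤ p ^ t :=
  natCard_fixedPoints_geomPrimaryTorsion_le_pow W p
    ((Rank2Sha.padicValNat_torsionOrder_le_of_good W p ℓ h3 hgood).trans hℓ)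

/-! ## §2 The torsion-tolerant gap door in certificate currency -/

/-- **Gap from `(0, j')` counts with rational `2`-torsion**: PRINT `hB` (finiteness of `E(ℚ_∞)[2^∞]`,
Greenberg LNM 1716 §1) + CERT {`2^a ≤ #Sel_{2^∞}(E/ℚ)[2]`, `#A_{j'}[2] ≤ 2^d`, `ord₂ #E(ℚ)_tors ≤ t`,
`d + t + 1 ≤ 2^{j'} − 1 + a`} ⇒ `O1.TowerGapAtTwo W`. [cite: GreenbergLNM1716, §1 p. 60 and p. 62, §3 pp. 85–86, §4 Lemma 4.3] -/
theorem towerGapAtTwo_of_counts_of_torsionOrder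
    (hB : Greenberg1999.finite_torsion_cyclotomicZpExtension) {j' a d t : ℕ}
    (hlow : ∀ κ : ZpExtension ℚ 2, κ.IsCyclotomic →
      2 ^ a ≤ Nat.card {z : W.selmerLayer κ 0 // 2 • z = 0})
    (hup : ∀ κ : ZpExtension ℚ 2, κ.IsCyclotomic →
      Nat.card {z : W.selmerInftyPreimage κ j' // 2 • z = 0} ≤ 2 ^ d)
    (ht : padicValNat 2 W.torsionOrder ≤ t) (had : d + t + 1 ≤ 2 ^ j' - 1 + a) : TowerGapAtTwo W :=
  towerGapAtTwo_of_counts_of_torsion_zero W hB hlow (natCard_fixedPoints_geomPrimaryTorsion_le_pow W 2 ht)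
    hup had

/-- **Gap from `(0, j')` counts, torsion certificate from a good odd prime `ℓ`** (`ord₂ #Ẽ(𝔽_ℓ) ≤ t`,
kernel-decidable on an integer model). [cite: GreenbergLNM1716, §1 p. 60 and p. 62, §3 pp. 85–86, §4 Lemma 4.3]
[cite: SilvermanAEC2009, VII.3 Prop. 3.1(b)] -/
theorem towerGapAtTwo_of_counts_of_goodPrime [W.IsGloballyMinimal]
    (hB : Greenberg1999.finite_torsion_cyclotomicZpExtension) {j' a d t : ℕ} (ℓ : ℕ) [Fact ℓ.Prime]
    (h3 : 3 ≤ ℓ) (hgood : W.HasGoodReductionAtPrime ℓ) (hℓ : padicValNat 2 (W.reductionPointCount ℓ) ≤ t)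
    (hlow : ∀ κ : ZpExtension ℚ 2, κ.IsCyclotomic →
      2 ^ a ≤ Nat.card {z : W.selmerLayer κ 0 // 2 • z = 0})
    (hup : ∀ κ : ZpExtension ℚ 2, κ.IsCyclotomic →
      Nat.card {z : W.selmerInftyPreimage κ j' // 2 • z = 0} ≤ 2 ^ d)
    (had : d + t + 1 ≤ 2 ^ j' - 1 + a) : TowerGapAtTwo W :=
  towerGapAtTwo_of_counts_of_torsion_zero W hB hlow
    (natCard_fixedPoints_geomPrimaryTorsion_le_pow_of_good W 2 ℓ h3 hgood hℓ) hup had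

/-! ## §3 The doors AT `W` with the Néron-period binder displayed -/

/-- **Item `OrdKatoHalfAtTwoIso` (19573) AT `W` for reducible `E[2]`** (witness `W` itself): PRINT `h17` +
DISPLAYED `hper₀` (`ϖ·Ω(W) = Ω⁺_f ⇒ ord₂ ϖ ≥ 0`; print only at an `X₀`-optimal curve) + `GoodOrd W 2` + a gap
certificate. [cite: Kato2004Asterisque, Thm. 17.4 (1)(2) (p. 273)] [cite: MazurTateTeitelbaum1986Invent, §I.12] -/
theorem exists_isIsogenous_mainConjectureLowerDivisibilityAtTwoOrd_of_towerGap_of_neron [W.IsGloballyMinimal]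
    (h17 : ∀ [NeZero (W.conductorNorm ℤ)] (f : CuspForm (Gamma0 (W.conductorNorm ℤ)) 2),
      kato_divisibility_allPrimes W 2 (f := f))
    (hper₀ : ∀ [NeZero (W.conductorNorm ℤ)] (f : CuspForm (Gamma0 (W.conductorNorm ℤ)) 2),
      IsNewformOf W f → ∀ ϖ : ℚ, (ϖ : ℝ) * W.realPeriodRat = plusPeriod f → 0 ≤ padicValRat 2 ϖ)
    (hgo : GoodOrd W 2) (hgap : TowerGapAtTwo W) :
    ∃ (W' : WeierstrassCurve ℚ) (_ : W'.IsElliptic) (_ : W'.IsGloballyMinimal),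
      IsIsogenous W W' ∧ MainConjectureLowerDivisibilityAtTwoOrd W' :=
  ⟨W, inferInstance, inferInstance, IsIsogenous.refl_holds W,
    katoHalfAt_two_of_towerGap_of_neron W h17 hper₀ hgo hgap⟩

/-- **`MissingUpperBoundAt W 2` from a gap certificate with `hper₀` displayed** (analytic rank `0`): PRINT
{`hEC`, `hmod`, `hGZK`, `h17`} + `hper₀` + `hr` + the gap. [cite: GreenbergLNM1716, Thm. 4.1 (p. 102)]
[cite: Kato2004Asterisque, Thm. 17.4 (1)(2) (p. 273)] [cite: MazurTateTeitelbaum1986Invent, §I.12] -/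
theorem missingUpperBoundAt_two_of_towerGap_of_neron [W.IsGloballyMinimal] (hEC : TwoAdicEulerCharRankZero W 0)
    (hmod : nonempty_modularParametrizationData) (hGZK : rank_eq_analyticRank_of_analyticRank_le_one)
    (h17 : ∀ [NeZero (W.conductorNorm ℤ)] (f : CuspForm (Gamma0 (W.conductorNorm ℤ)) 2),
      kato_divisibility_allPrimes W 2 (f := f))
    (hper₀ : ∀ [NeZero (W.conductorNorm ℤ)] (f : CuspForm (Gamma0 (W.conductorNorm ℤ)) 2),
      IsNewformOf W f → ∀ ϖ : ℚ, (ϖ : ℝ) * W.realPeriodRat = plusPeriod f → 0 ≤ padicValRat 2 ϖ)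
    (hgo : GoodOrd W 2) (hr : W.analyticRank = 0) (hgap : TowerGapAtTwo W) : MissingUpperBoundAt W 2 := by
  have hord : IsOrdinaryAt W 2 := hgo
  refine missingUpperBoundAt_two_of_towerGap W hEC hmod hGZK h17 hgap ?_ hr hgo
  intro _ f hf ϖ hϖ
  exact exists_integral_mul_padicLFunction_two_of_padicValRat_nonneg W hord hf (hper₀ f hf ϖ hϖ)

/-! ## §4 (append) The point-count currency of the torsion certificate -/

/-- `¬ p^{t+1} ∣ n`, `n ≠ 0` ⇒ `ord_p n ≤ t` (the decidable form of a valuation bound). [folklore] -/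
theorem padicValNat_le_of_not_pow_succ_dvd {p n t : ℕ} [Fact p.Prime] (hn : n ≠ 0)
    (h : ¬ p ^ (t + 1) ∣ n) : padicValNat p n ≤ t :=
  Nat.lt_succ_iff.mp (not_le.mp fun hle ↦ h ((padicValNat_dvd_iff_le hn).mpr hle))

/-- **Gap from `(0, j')` counts, torsion certificate = a decidable point count**: a good odd prime `ℓ ≥ 3`
with `#Ẽ(𝔽_ℓ) = n` and `¬ 2^{t+1} ∣ n` (so `ord₂ #E(ℚ)_tors ≤ ord₂ n ≤ t`), plus the two layer counts and
`d + t + 1 ≤ 2^{j'} − 1 + a`. [cite: SilvermanAEC2009, VII.3 Prop. 3.1(b)]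
[cite: GreenbergLNM1716, §1 p. 60 and p. 62, §3 pp. 85–86, §4 Lemma 4.3] -/
theorem towerGapAtTwo_of_counts_of_goodPrime_card [W.IsGloballyMinimal]
    (hB : Greenberg1999.finite_torsion_cyclotomicZpExtension) {j' a d t n : ℕ} (ℓ : ℕ) [Fact ℓ.Prime]
    (h3 : 3 ≤ ℓ) (hgood : W.HasGoodReductionAtPrime ℓ) (hn : W.reductionPointCount ℓ = n)
    (hndvd : ¬ 2 ^ (t + 1) ∣ n)
    (hlow : ∀ κ : ZpExtension ℚ 2, κ.IsCyclotomic →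
      2 ^ a ≤ Nat.card {z : W.selmerLayer κ 0 // 2 • z = 0})
    (hup : ∀ κ : ZpExtension ℚ 2, κ.IsCyclotomic →
      Nat.card {z : W.selmerInftyPreimage κ j' // 2 • z = 0} ≤ 2 ^ d)
    (had : d + t + 1 ≤ 2 ^ j' - 1 + a) : TowerGapAtTwo W := by
  haveI : NeZero ℓ := ⟨(Fact.out : ℓ.Prime).ne_zero⟩
  have hn0 : n ≠ 0 := hn ▸ (reductionPointCount_pos W ℓ).ne'
  exact towerGapAtTwo_of_counts_of_goodPrime W hB ℓ h3 hgood
    (hn ▸ padicValNat_le_of_not_pow_succ_dvd hn0 hndvd) hlow hup had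

end Rat

end Summit.BirchSwinnertonDyer.BirchSwinnertonDyer.Theorems.TowerClass

end
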